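import Summits.ResolutionOfSingularities.ResolutionOfSingularities.Theorems.FrobeniusLadderFRationalResolutionFieldUniformCertificate
import Summits.ResolutionOfSingularities.ResolutionOfSingularities.Theorems.FrobeniusLadderFRationalResolutionConeCertificateModel
import Summits.ResolutionOfSingularities.ResolutionOfSingularities.Theorems.FrobeniusLadderFRationalResolutionMonoidAlgebraFreeRegular
import HarnessLib

/-!
# Crux `FrobeniusLadder.FRationalResolution` (stmt-ResolutionOfSingularities-15317), line `redirect`,
# stub `stub_diagonalizableQuotientResolution` — THE NAIVE TWO-STEP RECIPE FROM CONE CERTIFICATES, ALL IN ONE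

The entry points for class-provers of the naive two-step classes. At each singular point of `X` the data are the fixed-point data
of a quotient chart (as in `…MonoidAlgebraModel`, p843485) and a CONE CERTIFICATE of the weight kernel `P = ⟨G⟩ ⊆ ℕⁿ` — pure monoid
combinatorics plus two field-uniform regularity slots:

* an enumeration `gen` of `G`, non-zero vertices `v` and exponent identities `(jᵢ+1) • genᵢ = v_{c i} + Σ qᵢ` (`jᵢ + 1 ≤ k`);
* per vertex `vⱼ`: the cone monoid `(Q ⊆ ℕ^{n'}, ι : Q ↪ ℤⁿ)` of the chart `κ[P][𝔳/χ^{vⱼ}]` (three membership families), its finite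
  generating set `G_Q ∌ 0`, the regularity of the faces `κ[Q][1/χᵍ]` (`g ∈ G_Q`) over every field, and the vertex certificate of the
  monomial algebra of `G_Q` over every field.

* ★★★★ `hasResolution_of_isolated_fixedPoints_of_coneCertificate` — chains `…ConeCertificateModel.modelCertificate_of_cone` (p843632)
  into `…MonoidAlgebraModel.hasResolution_of_isolated_fixedPoints_of_fieldUniform_certificate` (the field-uniform consumer).
* ★★★★ `hasResolution_of_isolated_fixedPoints_of_unimodularConeCertificate` — the same with the face slot made COMBINATORIAL: for each
  `g ∈ G_Q` a face monoid `M` with an injective `ι' : M → ℤ^{n'}` onto `Q − ℕg` and an additive equivalence `M ≃+ ℕᵃ × ℤᵇ`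
  (`…MonoidAlgebraAwayStructure.isRegularRing_away_iff_of_monoid`, p843569, and `…MonoidAlgebraFreeRegular.isRegularRing_monoidAlgebra_of_addEquiv`,
  p843586).

Lean note: every existential package is bound with `have` before `obtain` (see `…FieldUniformCertificate`: `obtain` on an application
runs `generalize`, whose type-correctness check of the heavy per-point goal does not terminate in any reasonable budget).

Honest label: assembly toward ONE leaf stub (no stub, crux or summit closed). No definitions, no named facts, no sorry.
[cite: Kato1994, Thm. (3.2)] [cite: Kollar2007, §2.2] [folklore; cite: CoxLittleSchenck2011, §1.1, §3.3]
-/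

noncomputable section

-- single-problem summit: the doubled namespace component is forced
set_option linter.dupNamespace false

open CategoryTheory AlgebraicGeometry TopologicalSpace IsLocalRing
open Literature.AlgebraicGeometry.Resolution

namespace Summit.ResolutionOfSingularities.ResolutionOfSingularities.Theorems.FRationalResolution.MonoidAlgebraLaurent

/-- The exponent of `p ∈ ℕⁿ` in `ℤⁿ`. -/
local notation3 (prettyPrint := false) "toZ[" n "]" =>
  (Finsupp.mapRange.addMonoidHom (Nat.castAddMonoidHom ℤ) : (Fin n →₀ ℕ) →+ (Fin n →₀ ℤ))

/-- ★★★★ **RESOLUTION OF VARIETIES WHOSE SINGULAR POINTS ARE ISOLATED FIXED POINTS OF QUOTIENT CHARTS WITH A CONE CERTIFICATE.**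
`X` integral, locally of finite type over a field, finitely many singular points; at each: an étale quotient chart `Spec S₀ → X`
(`S` of finite type over a field, graded by a torsion group `A`) hitting it at a `D(A)`-fixed prime `𝔔` with homogeneous regular
parameters `x` of weights `a`, the weight kernel `P = {m : Σ mᵢ • aᵢ = 0} = ⟨G⟩` (`G` finite, `0 ∉ G`), and a cone certificate of `P`
(module docstring). Then `X` has a resolution of singularities: at every singular point the blow-up of the point followed by the
blow-up of the singular points of the vertex charts is the naive two-step recipe, étale-locally the toric one.
[cite: Kato1994, Thm. (3.2)] [cite: Kollar2007, §2.2] [folklore; cite: CoxLittleSchenck2011, §1.1, §3.3] -/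
theorem hasResolution_of_isolated_fixedPoints_of_coneCertificate (k : Type) [Field k] (X : Scheme.{0}) [IsIntegral X]
    (f : X ⟶ Spec (.of k)) [LocallyOfFiniteType f] (hfin : (Scheme.regularLocus X)ᶜ.Finite)
    (hchart : ∀ t : X, t ∉ Scheme.regularLocus X →
      ∃ (k' : Type) (_ : Field k') (A : Type) (_ : DecidableEq A) (_ : AddCommGroup A) (_ : AddMonoid.IsTorsion A)
        (S : Type) (_ : CommRing S) (_ : Algebra k' S) (𝒮 : A → Submodule k' S) (_ : GradedAlgebra 𝒮)
        (_ : Algebra.FiniteType k' S) (φ : Spec (.of (𝒮 0)) ⟶ X) (_ : Etale φ)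
        (𝔔 : Ideal S) (_ : 𝔔.IsPrime) (_ : ∀ a : A, a ≠ 0 → ∀ s ∈ 𝒮 a, s ∈ 𝔔)
        (n : ℕ) (x : Fin n → S) (a : Fin n → A) (P : AddSubmonoid (Fin n →₀ ℕ))
        (_ : ∀ i, x i ∈ 𝔔 ∧ x i ∈ 𝒮 (a i))
        (_ : Ideal.span (algebraMap S (Localization.AtPrime 𝔔) '' Set.range x) = maximalIdeal (Localization.AtPrime 𝔔))
        (_ : (n : WithBot ℕ∞) = ringKrullDim (Localization.AtPrime 𝔔))
        (_ : ∀ m, m ∈ P ↔ Finsupp.weight a m = 0)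
        (G : Set (Fin n →₀ ℕ)) (_ : G.Finite) (_ : (0 : Fin n →₀ ℕ) ∉ G) (_ : AddSubmonoid.closure G = P),
        φ ⟨𝔔.comap (algebraMap (𝒮 0) S), inferInstance⟩ = t ∧
        ∃ (N : ℕ) (gen : Fin N → ↥P) (_ : ∀ i, ((gen i : ↥P) : Fin n →₀ ℕ) ∈ G)
          (_ : ∀ g ∈ G, ∃ i, ((gen i : ↥P) : Fin n →₀ ℕ) = g)
          (m : ℕ) (v : Fin m → ↥P) (_ : ∀ j, v j ≠ 0)
          (kk : ℕ) (_ : 1 ≤ kk) (c : Fin N → Fin m) (jj : Fin N → ℕ) (_ : ∀ i, jj i + 1 ≤ kk)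
          (q : ∀ i, Fin (jj i) → ↥P) (_ : ∀ i l, q i l ≠ 0) (_ : ∀ i, (jj i + 1) • gen i = v (c i) + ∑ l, q i l),
          ∀ j : Fin m, ∃ (n' : ℕ) (Q : AddSubmonoid (Fin n' →₀ ℕ)) (ι : ↥Q →+ (Fin n →₀ ℤ)) (_ : Function.Injective ι)
            (_ : ∀ e : ↥P, e ≠ 0 → ∃ u : ↥Q, ι u = toZ[n] (e : Fin n →₀ ℕ) - toZ[n] ((v j : ↥P) : Fin n →₀ ℕ))
            (_ : ∀ p : ↥P, ∃ u : ↥Q, ι u = toZ[n] (p : Fin n →₀ ℕ))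
            (_ : ∀ u : ↥Q, ∃ (p : ↥P) (r : ℕ) (e : Fin r → ↥P), (∀ i, e i ≠ 0) ∧
              ι u = toZ[n] (p : Fin n →₀ ℕ) + ∑ i, (toZ[n] ((e i : ↥P) : Fin n →₀ ℕ) - toZ[n] ((v j : ↥P) : Fin n →₀ ℕ)))
            (GQ : Set (Fin n' →₀ ℕ)) (_ : GQ.Finite) (_ : (0 : Fin n' →₀ ℕ) ∉ GQ) (_ : AddSubmonoid.closure GQ = Q),
            (∀ (κ : Type) [Field κ], ∀ u : ↥Q, (u : Fin n' →₀ ℕ) ∈ GQ →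
              IsRegularRing (Localization.Away (AddMonoidAlgebra.single u (1 : κ)))) ∧
            (∀ (K : Type) [Field K], Scheme.IsRegular (affineBlowup (Ideal.span {w : ↥(Algebra.adjoin K
              ((fun d : Fin n' →₀ ℕ => MvPolynomial.monomial d (1 : K)) '' GQ)) |
              ∃ d ∈ GQ, (w : MvPolynomial (Fin n') K) = MvPolynomial.monomial d 1})))) :
    Scheme.HasResolution X := by
  refine MonoidAlgebraModel.hasResolution_of_isolated_fixedPoints_of_fieldUniform_certificate k X f hfin fun t ht => ?_
  have hc := hchart t ht
  obtain ⟨k', ik, A, iA₁, iA₂, hA, S, iS₁, iS₂, 𝒮, i𝒮, iS₃, φ, iφ, 𝔔, i𝔔, hfix, n, x, a, P, hxa, hspan, hn, hP, G, hGfin, hG0,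
    hGP, hφt, N, gen, hgenG, hGgen, m, v, hv0, kk, hkk, c, jj, hjj, q, hq0, hid, hcone⟩ := hc
  refine ⟨k', ik, A, iA₁, iA₂, hA, S, iS₁, iS₂, 𝒮, i𝒮, iS₃, φ, iφ, 𝔔, i𝔔, hfix, n, x, a, P, hxa, hspan, hn, hP, G, hGfin, hG0, hGP,
    hφt, fun κ _ => ?_⟩
  -- the model-side package of `κ[P]` from the cone data, for THIS field `κ`
  refine modelCertificate_of_cone κ P G hG0 hGP gen hgenG hGgen v hv0 kk hkk c jj hjj q hq0 hid fun j => ?_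
  have hj := hcone j
  obtain ⟨n', Q, ι, hι, hE, hPQ, hQ, GQ, hGQfin, hGQ0, hGQ, hface, hvert⟩ := hj
  exact ⟨n', Q, ι, hι, hE, hPQ, hQ, GQ, hGQfin, hGQ0, hGQ, hface κ, fun K _ => hvert K⟩

/-- ★★★★ **THE SAME WITH UNIMODULAR FACE CERTIFICATES.** As `hasResolution_of_isolated_fixedPoints_of_coneCertificate`, the face slot
being replaced by COMBINATORIAL data: for every generator `g ∈ G_Q` of a vertex cone monoid `Q` a face monoid `M` with an injective
additive `ι' : M → ℤ^{n'}` such that every `ι' m` is `q − k g` (`q ∈ Q`), every `q ∈ Q` is an `ι' m`, `−g` is an `ι' m₀`, and an additive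
equivalence `M ≃+ ℕᵃ × ℤᵇ` (so `κ[Q][1/χᵍ] ≅ κ[M] ≅ κ[ℕᵃ × ℤᵇ]` is regular over every field).
[cite: Kato1994, Thm. (3.2)] [cite: Kollar2007, §2.2] [folklore; cite: CoxLittleSchenck2011, §1.1, §3.3] -/
theorem hasResolution_of_isolated_fixedPoints_of_unimodularConeCertificate (k : Type) [Field k] (X : Scheme.{0}) [IsIntegral X]
    (f : X ⟶ Spec (.of k)) [LocallyOfFiniteType f] (hfin : (Scheme.regularLocus X)ᶜ.Finite)
    (hchart : ∀ t : X, t ∉ Scheme.regularLocus X →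
      ∃ (k' : Type) (_ : Field k') (A : Type) (_ : DecidableEq A) (_ : AddCommGroup A) (_ : AddMonoid.IsTorsion A)
        (S : Type) (_ : CommRing S) (_ : Algebra k' S) (𝒮 : A → Submodule k' S) (_ : GradedAlgebra 𝒮)
        (_ : Algebra.FiniteType k' S) (φ : Spec (.of (𝒮 0)) ⟶ X) (_ : Etale φ)
        (𝔔 : Ideal S) (_ : 𝔔.IsPrime) (_ : ∀ a : A, a ≠ 0 → ∀ s ∈ 𝒮 a, s ∈ 𝔔)
        (n : ℕ) (x : Fin n → S) (a : Fin n → A) (P : AddSubmonoid (Fin n →₀ ℕ))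
        (_ : ∀ i, x i ∈ 𝔔 ∧ x i ∈ 𝒮 (a i))
        (_ : Ideal.span (algebraMap S (Localization.AtPrime 𝔔) '' Set.range x) = maximalIdeal (Localization.AtPrime 𝔔))
        (_ : (n : WithBot ℕ∞) = ringKrullDim (Localization.AtPrime 𝔔))
        (_ : ∀ m, m ∈ P ↔ Finsupp.weight a m = 0)
        (G : Set (Fin n →₀ ℕ)) (_ : G.Finite) (_ : (0 : Fin n →₀ ℕ) ∉ G) (_ : AddSubmonoid.closure G = P),
        φ ⟨𝔔.comap (algebraMap (𝒮 0) S), inferInstance⟩ = t ∧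
        ∃ (N : ℕ) (gen : Fin N → ↥P) (_ : ∀ i, ((gen i : ↥P) : Fin n →₀ ℕ) ∈ G)
          (_ : ∀ g ∈ G, ∃ i, ((gen i : ↥P) : Fin n →₀ ℕ) = g)
          (m : ℕ) (v : Fin m → ↥P) (_ : ∀ j, v j ≠ 0)
          (kk : ℕ) (_ : 1 ≤ kk) (c : Fin N → Fin m) (jj : Fin N → ℕ) (_ : ∀ i, jj i + 1 ≤ kk)
          (q : ∀ i, Fin (jj i) → ↥P) (_ : ∀ i l, q i l ≠ 0) (_ : ∀ i, (jj i + 1) • gen i = v (c i) + ∑ l, q i l),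
          ∀ j : Fin m, ∃ (n' : ℕ) (Q : AddSubmonoid (Fin n' →₀ ℕ)) (ι : ↥Q →+ (Fin n →₀ ℤ)) (_ : Function.Injective ι)
            (_ : ∀ e : ↥P, e ≠ 0 → ∃ u : ↥Q, ι u = toZ[n] (e : Fin n →₀ ℕ) - toZ[n] ((v j : ↥P) : Fin n →₀ ℕ))
            (_ : ∀ p : ↥P, ∃ u : ↥Q, ι u = toZ[n] (p : Fin n →₀ ℕ))
            (_ : ∀ u : ↥Q, ∃ (p : ↥P) (r : ℕ) (e : Fin r → ↥P), (∀ i, e i ≠ 0) ∧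
              ι u = toZ[n] (p : Fin n →₀ ℕ) + ∑ i, (toZ[n] ((e i : ↥P) : Fin n →₀ ℕ) - toZ[n] ((v j : ↥P) : Fin n →₀ ℕ)))
            (GQ : Set (Fin n' →₀ ℕ)) (_ : GQ.Finite) (_ : (0 : Fin n' →₀ ℕ) ∉ GQ) (_ : AddSubmonoid.closure GQ = Q),
            (∀ u : ↥Q, (u : Fin n' →₀ ℕ) ∈ GQ →
              ∃ (M : Type) (_ : AddCommMonoid M) (ι' : M →+ (Fin n' →₀ ℤ)) (_ : Function.Injective ι')
                (_ : ∀ w : M, ∃ (q' : ↥Q) (l : ℕ), ι' w + l • toZ[n'] ((u : ↥Q) : Fin n' →₀ ℕ) = toZ[n'] ((q' : ↥Q) : Fin n' →₀ ℕ))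
                (_ : ∀ q' : ↥Q, ∃ w : M, ι' w = toZ[n'] ((q' : ↥Q) : Fin n' →₀ ℕ))
                (_ : ∃ w₀ : M, ι' w₀ + toZ[n'] ((u : ↥Q) : Fin n' →₀ ℕ) = 0)
                (na nb : ℕ), Nonempty (M ≃+ (Fin na →₀ ℕ) × (Fin nb →₀ ℤ))) ∧
            (∀ (K : Type) [Field K], Scheme.IsRegular (affineBlowup (Ideal.span {w : ↥(Algebra.adjoin K
              ((fun d : Fin n' →₀ ℕ => MvPolynomial.monomial d (1 : K)) '' GQ)) |
              ∃ d ∈ GQ, (w : MvPolynomial (Fin n') K) = MvPolynomial.monomial d 1})))) :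
    Scheme.HasResolution X := by
  refine hasResolution_of_isolated_fixedPoints_of_coneCertificate k X f hfin fun t ht => ?_
  have hc := hchart t ht
  obtain ⟨k', ik, A, iA₁, iA₂, hA, S, iS₁, iS₂, 𝒮, i𝒮, iS₃, φ, iφ, 𝔔, i𝔔, hfix, n, x, a, P, hxa, hspan, hn, hP, G, hGfin, hG0,
    hGP, hφt, N, gen, hgenG, hGgen, m, v, hv0, kk, hkk, c, jj, hjj, q, hq0, hid, hcone⟩ := hc
  refine ⟨k', ik, A, iA₁, iA₂, hA, S, iS₁, iS₂, 𝒮, i𝒮, iS₃, φ, iφ, 𝔔, i𝔔, hfix, n, x, a, P, hxa, hspan, hn, hP, G, hGfin, hG0, hGP,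
    hφt, N, gen, hgenG, hGgen, m, v, hv0, kk, hkk, c, jj, hjj, q, hq0, hid, fun j => ?_⟩
  have hj := hcone j
  obtain ⟨n', Q, ι, hι, hE, hPQ, hQ, GQ, hGQfin, hGQ0, hGQ, hface, hvert⟩ := hj
  refine ⟨n', Q, ι, hι, hE, hPQ, hQ, GQ, hGQfin, hGQ0, hGQ, fun κ _ u hu => ?_, hvert⟩
  -- the face `κ[Q][1/χᵘ] ≅ κ[M] ≅ κ[ℕᵃ × ℤᵇ]` is regular
  have hu' := hface u hu
  obtain ⟨M, iM, ι', hι', hM, hQM, hgM, na, nb, ⟨e⟩⟩ := hu'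
  exact (isRegularRing_away_iff_of_monoid κ Q u ι' hι' hM hQM hgM).mpr (isRegularRing_monoidAlgebra_of_addEquiv κ e)

end Summit.ResolutionOfSingularities.ResolutionOfSingularities.Theorems.FRationalResolution.MonoidAlgebraLaurent

end
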